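import Mathlib.Topology.Order.Compact
import Mathlib.Topology.Algebra.Order.Field
import Mathlib.Analysis.SpecialFunctions.Pow.Real
import HarnessLib

/-!
# The all-`t` endgame of `stub_modulationBootstrap` with the SHARP constant, by Schwarz's maximum principle
# (drefute gen-3 by-product for line `uv-thomson-force-wave`, crux `StaticResponseBound`, stmt-AtomisticToContinuum-12057)

Pure real analysis, no physics.  In S3 (`ModulationBootstrap`) the modulated ground-state energy
`E(s) = inf_Ψ {E_w(Ψ) + s⟨V_p⟩_Ψ}` is continuous (even `N`-Lipschitz), satisfies `E(t) ≤ E(0)` for all `t`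
(translation averaging, `k ≠ 0`), and — this is what the hypothesis (H) `χ_s ≤ K` delivers at each coupling `s`
of the window through the ground-state representation and a fixed-volume spectral gap — the LOCAL second-order
bound `E(s+δ) + E(s−δ) − 2E(s) ≥ −2(K+ε)δ²` for `0 < δ < δ₀(s, ε)`.  The theorem below turns exactly these three
facts into the conclusion `E(t) ≥ E(0) − K t²` on the whole window `t² ≤ T`, with the sharp constant `K`
(not `2K`), WITHOUT derivatives, absolute continuity, the fundamental theorem of calculus or analytic (Kato)
perturbation theory: if `g = E + Kx²` dipped below `g(0)` at some `t`, the function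
`h = g − chord + ηx(x−t)` would have a maximum on `[0,t]`; at an interior maximum the symmetric second
difference of `h` is `≤ 0` but equals `[E-second difference] + 2Kδ² + 2ηδ² ≥ ηδ² > 0`; at a boundary maximum
`h ≤ 0` forces `E(x) ≤ E(0) + (3m/4)x` near `0⁺` (`m < 0` the chord slope), and then the second difference at
`s = 0` gives `E(−δ) > E(0)`, contradicting `E ≤ E(0)`.  [folklore: H. A. Schwarz's generalized second-derivative
test / maximum principle for the symmetric second derivative, Zygmund, Trigonometric Series I, Ch. I (10.7)]
-/

namespace Summit.AtomisticToContinuum.BoseEinsteinCondensation.Theorems.StaticResponseBound.Negative.UvThomsonG3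

open Set

/-- One-sided Schwarz endgame (`t > 0`). [folklore] -/
theorem quadratic_lower_bound_of_second_differences_pos {E : ℝ → ℝ} {K T : ℝ} (hK : 0 ≤ K)
    (hE : Continuous E) (hmax : ∀ t, E t ≤ E 0)
    (h2 : ∀ s : ℝ, s ^ 2 ≤ T → ∀ ε : ℝ, 0 < ε → ∃ δ₀ : ℝ, 0 < δ₀ ∧ ∀ δ : ℝ, 0 < δ → δ < δ₀ →
      -(2 * (K + ε) * δ ^ 2) ≤ E (s + δ) + E (s - δ) - 2 * E s)
    {t : ℝ} (ht : 0 < t) (htT : t ^ 2 ≤ T) : E 0 - K * t ^ 2 ≤ E t := by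
  by_contra hlt
  push Not at hlt
  -- the chord slope of `g = E + Kx²` on `[0, t]`
  set m : ℝ := (E t + K * t ^ 2 - E 0) / t with hm_def
  have hmt : m * t = E t + K * t ^ 2 - E 0 := by
    rw [hm_def]; field_simp
  have hm : m < 0 := by
    rw [hm_def]; exact div_neg_of_neg_of_pos (by linarith) ht
  -- the quadratic bump
  set η : ℝ := -m / (4 * t) with hη_def
  have hη : 0 < η := by rw [hη_def]; exact div_pos (by linarith) (by linarith)
  have hηt : η * t = -m / 4 := by rw [hη_def]; field_simp
  set ε : ℝ := η / 2 with hε_def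
  have hε : 0 < ε := by rw [hε_def]; linarith
  have hKε : 0 < K + ε := by linarith
  -- the auxiliary function, vanishing at both ends of `[0, t]`
  set h : ℝ → ℝ := fun x => E x + K * x ^ 2 - E 0 - m * x + η * x * (x - t) with hh_def
  have hh0 : h 0 = 0 := by simp [hh_def]
  have hht : h t = 0 := by
    simp only [hh_def, sub_self, mul_zero, add_zero]; linarith
  have hcont : Continuous h := by
    rw [hh_def]; fun_prop
  obtain ⟨c, hc, hcmax⟩ :=
    (isCompact_Icc (a := (0 : ℝ)) (b := t)).exists_isMaxOn (nonempty_Icc.2 ht.le) hcont.continuousOn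
  have hle : ∀ x, x ∈ Icc (0 : ℝ) t → h x ≤ h c := fun x hx => hcmax hx
  by_cases hint : 0 < c ∧ c < t
  · -- interior maximum: the symmetric second difference of `h` at `c` is `≤ 0`, but it is `≥ ηδ² > 0`
    obtain ⟨hc0, hct⟩ := hint
    have hcT : c ^ 2 ≤ T := by nlinarith
    obtain ⟨δ₀, hδ₀, H⟩ := h2 c hcT ε hε
    set δ : ℝ := min (δ₀ / 2) (min (c / 2) ((t - c) / 2)) with hδ_def
    have hδpos : 0 < δ := by
      rw [hδ_def]; exact lt_min (by linarith) (lt_min (by linarith) (by linarith))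
    have hδ₀' : δ < δ₀ := lt_of_le_of_lt (min_le_left _ _) (by linarith)
    have hδc : δ ≤ c / 2 := le_trans (min_le_right _ _) (min_le_left _ _)
    have hδt : δ ≤ (t - c) / 2 := le_trans (min_le_right _ _) (min_le_right _ _)
    have H1 := H δ hδpos hδ₀'
    have hp := hle (c + δ) ⟨by linarith, by linarith⟩
    have hq := hle (c - δ) ⟨by linarith, by linarith⟩
    have hsum : h (c + δ) + h (c - δ) - 2 * h c ≤ 0 := by linarith
    have hexp : h (c + δ) + h (c - δ) - 2 * h c =
        (E (c + δ) + E (c - δ) - 2 * E c) + 2 * K * δ ^ 2 + 2 * η * δ ^ 2 := by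
      simp only [hh_def]; ring
    have hδ2 : 0 < δ ^ 2 := by positivity
    have : η * δ ^ 2 ≤ 0 := by
      have hεη : ε = η / 2 := hε_def
      nlinarith [hsum, hexp, H1, hδ2]
    nlinarith
  · -- boundary maximum: `h ≤ 0` on `[0, t]`
    have hc_eq : h c = 0 := by
      rcases not_and_or.mp hint with h1 | h1
      · have : c = 0 := le_antisymm (not_lt.mp h1) hc.1
        rw [this, hh0]
      · have : c = t := le_antisymm hc.2 (not_lt.mp h1)
        rw [this, hht]
    have hle0 : ∀ x, x ∈ Icc (0 : ℝ) t → h x ≤ 0 := fun x hx => (hle x hx).trans_eq hc_eq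
    -- second difference at `s = 0`
    have h0T : (0 : ℝ) ^ 2 ≤ T := by nlinarith
    obtain ⟨δ₀, hδ₀, H⟩ := h2 0 h0T ε hε
    set δ : ℝ := min (δ₀ / 2) (min (t / 2) (-m / (8 * (K + ε)))) with hδ_def
    have hmpos : 0 < -m / (8 * (K + ε)) := div_pos (by linarith) (by linarith)
    have hδpos : 0 < δ := by
      rw [hδ_def]; exact lt_min (by linarith) (lt_min (by linarith) hmpos)
    have hδ₀' : δ < δ₀ := lt_of_le_of_lt (min_le_left _ _) (by linarith)
    have hδt : δ ≤ t / 2 := le_trans (min_le_right _ _) (min_le_left _ _)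
    have hδm : δ ≤ -m / (8 * (K + ε)) := le_trans (min_le_right _ _) (min_le_right _ _)
    have hδm' : 8 * (K + ε) * δ ≤ -m := by
      have := mul_le_mul_of_nonneg_left hδm (by linarith : (0 : ℝ) ≤ 8 * (K + ε))
      rwa [mul_div_cancel₀ _ (by positivity : (8 : ℝ) * (K + ε) ≠ 0)] at this
    have H1 := H δ hδpos hδ₀'
    simp only [zero_add, zero_sub] at H1
    -- from `h δ ≤ 0`: `E δ ≤ E 0 + (3m/4) δ`
    have hx := hle0 δ ⟨hδpos.le, by linarith⟩
    have hEδ : E δ ≤ E 0 + 3 / 4 * (m * δ) := by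
      have hexp : h δ = (E δ - E 0 - 3 / 4 * (m * δ)) + K * δ ^ 2 + η * δ ^ 2 - (η * t + m / 4) * δ := by
        simp only [hh_def]; ring
      rw [hηt] at hexp
      have hzero : (-m / 4 + m / 4) * δ = 0 := by ring
      rw [hzero, sub_zero] at hexp
      have hKδ2 : 0 ≤ K * δ ^ 2 := by positivity
      have hηδ2 : 0 ≤ η * δ ^ 2 := by positivity
      linarith
    -- hence `E (−δ) > E 0`, contradicting `hmax`
    have hneg := hmax (-δ)
    have hprod : 2 * (K + ε) * δ ^ 2 ≤ (-1 / 4) * (m * δ) := by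
      have h1 : 2 * (K + ε) * δ ≤ -m / 4 := by linarith
      calc 2 * (K + ε) * δ ^ 2 = δ * (2 * (K + ε) * δ) := by ring
        _ ≤ δ * (-m / 4) := mul_le_mul_of_nonneg_left h1 hδpos.le
        _ = (-1 / 4) * (m * δ) := by ring
    have r3 : m * δ < 0 := mul_neg_of_neg_of_pos hm hδpos
    linarith

/-- **Schwarz endgame for S3 (sharp constant, no calculus).** Let `E : ℝ → ℝ` be continuous with a global
maximum at `0` and local symmetric second differences bounded below by `−2(K+ε)δ²` (every `ε > 0`, all small
`δ`, at every point of the window `s² ≤ T`).  Then `E 0 − K t² ≤ E t` for every `t² ≤ T`.  In the line this is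
the step "(H) at every coupling of the window ⇒ `E₀ − K t² ≤ E_w(Ψ) + t⟨∑cos⟩_Ψ`" once the local bound is known;
the `t < 0` half follows from the `t > 0` half applied to `x ↦ E(−x)`. [folklore: Schwarz / Zygmund I (10.7)] -/
theorem quadratic_lower_bound_of_second_differences {E : ℝ → ℝ} {K T : ℝ} (hK : 0 ≤ K)
    (hE : Continuous E) (hmax : ∀ t, E t ≤ E 0)
    (h2 : ∀ s : ℝ, s ^ 2 ≤ T → ∀ ε : ℝ, 0 < ε → ∃ δ₀ : ℝ, 0 < δ₀ ∧ ∀ δ : ℝ, 0 < δ → δ < δ₀ →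
      -(2 * (K + ε) * δ ^ 2) ≤ E (s + δ) + E (s - δ) - 2 * E s)
    (t : ℝ) (htT : t ^ 2 ≤ T) : E 0 - K * t ^ 2 ≤ E t := by
  rcases lt_trichotomy t 0 with ht | rfl | ht
  · -- reflect
    have key := quadratic_lower_bound_of_second_differences_pos (E := fun x => E (-x)) (K := K) (T := T) hK
      (hE.comp continuous_neg) (fun s => by simpa using hmax (-s))
      (fun s hs ε hε => by
        obtain ⟨δ₀, hδ₀, H⟩ := h2 (-s) (by simpa using hs) ε hε
        refine ⟨δ₀, hδ₀, fun δ hδ hδ' => ?_⟩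
        have := H δ hδ hδ'
        have e1 : -(s + δ) = -s - δ := by ring
        have e2 : -(s - δ) = -s + δ := by ring
        simp only [e1, e2]
        linarith)
      (t := -t) (by linarith) (by simpa using htT)
    simpa using key
  · simp
  · exact quadratic_lower_bound_of_second_differences_pos hK hE hmax h2 ht htT

end Summit.AtomisticToContinuum.BoseEinsteinCondensation.Theorems.StaticResponseBound.Negative.UvThomsonG3
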